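import Mathlib
import Summits.RiemannHypothesis.RiemannHypothesis.Theorems.IntegerScrewTheoremAPrep
import HarnessLib

/-!
# Route `IntegerScrew` — THEOREM A PACKAGED: the flat window law for the all-integer atom as ONE inequality
# with an absolute constant, uniformly in the window (CONTINUUM-LIMIT §26.2)

For the all-integer atom `Ω_R = {1,…,R}` with harmonic weights, window `W = (Q, R]`, bottom `B = [1, Q]`,
`c = exitMassRatio R Q = (Σ_{Q<x≤R} 1/x)/(Σ_{b≤Q} 1/b)` and the unnormalised `t`-time Dirichlet form
`D(g) = Σ_{x≤R}(1/x)Σ_{n∣x}Λ(n)(g(x) − g(x/n))²`: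

* **`theoremA`** — for `148 ≤ Q`, `2Q ≤ R` and every `g : ℕ → ℝ`,
  `(Σ_{Q<x≤R} g(x)/x − c·Σ_{b≤Q} g(b)/b)² ≤ 210000 · (log R/log Q)² · D(g)`.

No hypothesis ties `Q` to `R` beyond `2Q ≤ R`: the window may be as thick as `log R/log Q → ∞`.  In κ-units
(`κ = ε²(1−ε)·log R·𝓔*(σ_W − σ_B)`, `ε = S_W/H_R`; `κ ≤ (1−ε)(log R/H_R)·[WF²/D] ≲ (log Q/log R)·[WF²/D]`) this is
`κ(Ω_R; R/Q) = O(log R/log Q) = O(1/(1−δ))` for ALL windows — THEOREM A of CONTINUUM-LIMIT §25.5 without the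
restriction `δ ≤ δ₀ < 1`, with the residual of order `X` (`X = log R/log Q`; the SHAPE of the measured law
`κ ≈ 0.9δ/(1−δ)`) instead of the `X⁴` of the constant-`A` Green bounds with PROP. 24.7 on `Ω_R` (§26.1–26.2: sharp
Green function + PROP. 24.7 applied on the BOTTOM `Ω_Q`).  The constant is poor (`e⁵` from the crude Mertens product bound of PROP. 24.7 and
`20²` from the density range) and is not optimised; the truth is `κ ≈ 0.9·δ/(1−δ)` (§24.5).

Ingredients, all kernel facts of this route: `window_functional_sq_le_exp_five` (THEOREM A's skeleton,
`IntegerScrewExitAssembly`), the sharp Green bounds `exitGamma_le_sharp'` / `le_exitGamma_sharp'` at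
`κ = 4`, `κ′ = 5` (`IntegerScrewExitGreenSharp`), the density sandwich `mul_exitInflow_le` / `le_mul_exitInflow`
(`IntegerScrewExitDensity`), the lower Mertens constant `c′ = 1`
(`Literature…MertensFirstLower.log_sub_one_le_sum_vonMangoldt_div'`), three numerical facts and
`exitChiSq_le_of_range` (values in `[m_lo, m_hi]` ⇒ `exitChiSq ≤ H_Q·(m_hi − m_lo)²`), all in
`IntegerScrewTheoremAPrep`; here:

* `density_range_width_le` — with `A = 1 + 4/log(Q+1)`, `B = 1 − 5/log(Q+1)`, `c′ = 1`:
  `A·log R·U₀ − B·log R·L₀ ≤ 20·log R/log²(Q+1)`;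
* `exitChiSq_le_sharp` — `exitChiSq R Q ≤ 400(1 + log Q)·log²R/log⁴(Q+1)`;
* **`theoremA`**.

RH-free, elementary.  Nothing in this file bears on the truth of RH.
References: CONTINUUM-LIMIT §25.5, §26.1–26.2 (rh-explicit A6-PIVOT); M. Suzuki, J. Lond. Math. Soc. (2) 108
(2023) 1448–1487 [Suzuki2023] for the screw matrices this serves; Hardy–Wright Thm 424 [HardyWright2008].
-/

noncomputable section

set_option linter.dupNamespace false -- D-0017: `Summit.<S>.<S>.…` is the designed namespace

namespace Summit.RiemannHypothesis.RiemannHypothesis.Theorems.IntegerScrew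

open Finset Real
open ArithmeticFunction (vonMangoldt)

/-! ### The width of the density range -/

/-- **The density range.**  With `a = log(Q+1)`, `L = log R`, `A = 1 + 4/a`, `B = 1 − 5/a`, `c′ = 1`, the two
bounds of `IntegerScrewExitDensity` are `U = A·L·(1/a − 1/L + (39/50 + 1 + 2 log 2)/a²)` and
`Lo = B·L·(1/log 2Q − 1/(L − log 2) − (39/50 + 1 + log 2)/a²)`; for `Q ≥ 148`, `2Q ≤ R`:  `U − Lo ≤ 20·L/a²`
(`(A−B)L/a = 9L/a²`; `1/a − 1/log 2Q ≤ log 2/a²`; `L/(L − log 2) − 1 ≤ 2 log 2·L/a²`; `A·c₂ + B·c₃ ≤ 8.18`). -/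
theorem density_range_width_le {R Q : ℕ} (hQ : 148 ≤ Q) (hQR : 2 * Q ≤ R) :
    (1 + 4 / Real.log ((Q : ℝ) + 1)) * Real.log R *
        (1 / Real.log ((Q : ℝ) + 1) - 1 / Real.log R + (39 / 50 + 1 + 2 * Real.log 2) / Real.log ((Q : ℝ) + 1) ^ 2) -
      (1 - 5 / Real.log ((Q : ℝ) + 1)) * Real.log R *
        (1 / Real.log (2 * (Q : ℝ)) - 1 / (Real.log R - Real.log 2) -
          (39 / 50 + 1 + Real.log 2) / Real.log ((Q : ℝ) + 1) ^ 2) ≤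
      20 * Real.log R / Real.log ((Q : ℝ) + 1) ^ 2 := by
  have hl2 := Real.log_two_lt_d9
  have hl2' := Real.log_two_gt_d9
  set a := Real.log ((Q : ℝ) + 1) with ha_def
  set L := Real.log (R : ℝ) with hL_def
  set m := Real.log (2 * (Q : ℝ)) with hm_def
  have ha5 : 5 ≤ a := five_le_log_succ hQ
  have ha0 : 0 < a := by linarith
  have hQ1 : (1 : ℝ) ≤ Q := by exact_mod_cast (show 1 ≤ Q by omega)
  -- a ≤ m ≤ L, m ≤ a + log 2
  have ham : a ≤ m := Real.log_le_log (by positivity) (by linarith)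
  have hmL : m ≤ L := Real.log_le_log (by positivity) (by exact_mod_cast hQR)
  have hma : m ≤ a + Real.log 2 := by
    rw [hm_def, ha_def, ← Real.log_mul (by positivity) (by norm_num)]
    exact Real.log_le_log (by positivity) (by linarith)
  have haL : a ≤ L := ham.trans hmL
  have hL0 : 0 < L := by linarith
  have hm0 : 0 < m := by linarith
  have hL2 : 0 < L - Real.log 2 := by linarith
  set A := 1 + 4 / a with hA_def
  set B := 1 - 5 / a with hB_def
  have h4a : 0 ≤ 4 / a := by positivity
  have h5a : 0 ≤ 5 / a := by positivity
  have h4a' : 4 / a ≤ 4 / 5 := div_le_div_of_nonneg_left (by norm_num) (by norm_num) ha5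
  have h5a' : 5 / a ≤ 5 / 5 := div_le_div_of_nonneg_left (by norm_num) (by norm_num) ha5
  have hA1 : 1 ≤ A := by rw [hA_def]; linarith
  have hA2 : A ≤ 9 / 5 := by rw [hA_def]; linarith
  have hB0 : 0 ≤ B := by rw [hB_def]; linarith
  have hB1 : B ≤ 1 := by rw [hB_def]; linarith
  have hAB : A - B = 9 / a := by rw [hA_def, hB_def]; ring
  set c₂ := 39 / 50 + 1 + 2 * Real.log 2 with hc₂
  set c₃ := 39 / 50 + 1 + Real.log 2 with hc₃
  -- the split
  have hsplit : A * L * (1 / a - 1 / L + c₂ / a ^ 2) - B * L * (1 / m - 1 / (L - Real.log 2) - c₃ / a ^ 2) =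
      ((A - B) * L / a + B * L * (1 / a - 1 / m)) + (B * L / (L - Real.log 2) - A) + (A * c₂ + B * c₃) * L / a ^ 2 := by
    field_simp
    ring
  rw [hsplit, hAB]
  -- P1a: (9/a)·L/a = 9L/a²
  have hP1a : 9 / a * L / a = 9 * L / a ^ 2 := by field_simp
  -- P1b: B L (1/a − 1/m) ≤ log 2·L/a²
  have hP1b : B * L * (1 / a - 1 / m) ≤ Real.log 2 * L / a ^ 2 := by
    have hd : 1 / a - 1 / m = (m - a) / (a * m) := by field_simp
    have hd1 : (m - a) / (a * m) ≤ Real.log 2 / (a * m) := div_le_div_of_nonneg_right (by linarith) (by positivity)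
    have hd2 : Real.log 2 / (a * m) ≤ Real.log 2 / (a * a) :=
      div_le_div_of_nonneg_left (by linarith) (by positivity) (by nlinarith)
    have hnn : 0 ≤ 1 / a - 1 / m := by rw [hd]; exact div_nonneg (by linarith) (by positivity)
    calc B * L * (1 / a - 1 / m) ≤ 1 * L * (1 / a - 1 / m) := by gcongr
      _ ≤ 1 * L * (Real.log 2 / (a * a)) := by
          refine mul_le_mul_of_nonneg_left (by rw [hd]; exact hd1.trans hd2) (by linarith)
      _ = Real.log 2 * L / a ^ 2 := by rw [sq]; ring
  -- P2: B L/(L − log 2) − A ≤ L/(L − log 2) − 1 = log 2/(L − log 2) ≤ 2 log 2/L ≤ 2 log 2·L/a²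
  have hP2 : B * L / (L - Real.log 2) - A ≤ 2 * Real.log 2 * L / a ^ 2 := by
    have h1 : B * L / (L - Real.log 2) ≤ L / (L - Real.log 2) :=
      div_le_div_of_nonneg_right (mul_le_of_le_one_left hL0.le hB1) hL2.le
    have h2 : L / (L - Real.log 2) - 1 = Real.log 2 / (L - Real.log 2) := by
      field_simp
      ring
    have h3 : Real.log 2 / (L - Real.log 2) ≤ 2 * Real.log 2 / L := by
      rw [div_le_div_iff₀ hL2 hL0]
      have : 0 ≤ Real.log 2 * (L - 2 * Real.log 2) := mul_nonneg (by linarith) (by linarith)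
      linarith
    have h4 : 2 * Real.log 2 / L ≤ 2 * Real.log 2 * L / a ^ 2 := by
      have ha2 : a ^ 2 ≤ L ^ 2 := pow_le_pow_left₀ ha0.le haL 2
      have e : 2 * Real.log 2 / L = 2 * Real.log 2 * L / L ^ 2 := by
        field_simp
      rw [e]
      exact div_le_div_of_nonneg_left (by positivity) (by positivity) ha2
    linarith
  -- P3: (A c₂ + B c₃) L/a² ≤ 8.18 L/a²
  have hP3 : (A * c₂ + B * c₃) * L / a ^ 2 ≤ 8.18 * L / a ^ 2 := by
    refine div_le_div_of_nonneg_right ?_ (by positivity)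
    refine mul_le_mul_of_nonneg_right ?_ hL0.le
    have hc2 : c₂ ≤ 3.1664 := by rw [hc₂]; linarith
    have hc3 : c₃ ≤ 2.4732 := by rw [hc₃]; linarith
    have hc20 : 0 ≤ c₂ := by rw [hc₂]; linarith
    have hc30 : 0 ≤ c₃ := by rw [hc₃]; linarith
    have e1 : A * c₂ ≤ 9 / 5 * c₂ := mul_le_mul_of_nonneg_right hA2 hc20
    have e2 : B * c₃ ≤ 1 * c₃ := mul_le_mul_of_nonneg_right hB1 hc30
    linarith
  -- sum: 9 + log 2 + 2 log 2 + 8.18 ≤ 20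
  have hLa : 0 ≤ L / a ^ 2 := by positivity
  have hsum : 9 * L / a ^ 2 + Real.log 2 * L / a ^ 2 + 2 * Real.log 2 * L / a ^ 2 + 8.18 * L / a ^ 2 ≤
      20 * L / a ^ 2 := by
    have : 9 * L / a ^ 2 + Real.log 2 * L / a ^ 2 + 2 * Real.log 2 * L / a ^ 2 + 8.18 * L / a ^ 2 =
        (9 + 3 * Real.log 2 + 8.18) * (L / a ^ 2) := by ring
    rw [this, show 20 * L / a ^ 2 = 20 * (L / a ^ 2) by ring]
    exact mul_le_mul_of_nonneg_right (by linarith) hLa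
  linarith [hP1a.le, hP1b, hP2, hP3, hsum]

/-! ### THEOREM A -/

/-- **The exit density's χ², explicitly**: for `148 ≤ Q`, `2Q ≤ R`,
`exitChiSq R Q ≤ (1 + log Q)·(20·log R/log²(Q+1))²`. -/
theorem exitChiSq_le_sharp {R Q : ℕ} (hQ : 148 ≤ Q) (hQR : 2 * Q ≤ R) :
    exitChiSq R Q ≤ (1 + Real.log Q) * (20 * Real.log R / Real.log ((Q : ℝ) + 1) ^ 2) ^ 2 := by
  have ha5 := five_le_log_succ hQ
  have hA1 : 1 ≤ 1 + 4 / Real.log ((Q : ℝ) + 1) := by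
    have : 0 ≤ 4 / Real.log ((Q : ℝ) + 1) := by positivity
    linarith
  have hB0 : 0 ≤ 1 - 5 / Real.log ((Q : ℝ) + 1) := by
    have : 5 / Real.log ((Q : ℝ) + 1) ≤ 5 / 5 := div_le_div_of_nonneg_left (by norm_num) (by norm_num) ha5
    linarith
  have hrange : ∀ b, 1 ≤ b → b ≤ Q → _ ≤ (b : ℝ) * exitInflow R Q b ∧ (b : ℝ) * exitInflow R Q b ≤ _ :=
    fun b hb hbQ =>
      ⟨le_mul_exitInflow hb hbQ (by omega) hQR hB0 (mertens_lower_one R) (five_le_exitGamma hQ),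
       mul_exitInflow_le hb hbQ hQR hA1 (exitGamma_le_four hQ) (mertens_lower_one R)⟩
  have h := exitChiSq_le_of_range (by omega) (by omega) hrange
  have hw := density_range_width_le hQ hQR
  have hH : 0 ≤ ∑ b ∈ Icc 1 Q, (1 : ℝ) / b := Finset.sum_nonneg fun b _ => by positivity
  -- the width is ≥ 0 (it bounds a non-empty range: take b = 1)
  have hw0 : 0 ≤ (1 + 4 / Real.log ((Q : ℝ) + 1)) * Real.log R *
        (1 / Real.log ((Q : ℝ) + 1) - 1 / Real.log R + (39 / 50 + 1 + 2 * Real.log 2) / Real.log ((Q : ℝ) + 1) ^ 2) -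
      (1 - 5 / Real.log ((Q : ℝ) + 1)) * Real.log R *
        (1 / Real.log (2 * (Q : ℝ)) - 1 / (Real.log R - Real.log 2) -
          (39 / 50 + 1 + Real.log 2) / Real.log ((Q : ℝ) + 1) ^ 2) := by
    have := hrange 1 le_rfl (by omega)
    linarith [this.1, this.2]
  calc exitChiSq R Q ≤ (∑ b ∈ Icc 1 Q, (1 : ℝ) / b) * _ ^ 2 := h
    _ ≤ (∑ b ∈ Icc 1 Q, (1 : ℝ) / b) * (20 * Real.log R / Real.log ((Q : ℝ) + 1) ^ 2) ^ 2 :=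
        mul_le_mul_of_nonneg_left (pow_le_pow_left₀ hw0 hw 2) hH
    _ ≤ (1 + Real.log Q) * (20 * Real.log R / Real.log ((Q : ℝ) + 1) ^ 2) ^ 2 :=
        mul_le_mul_of_nonneg_right (sum_Icc_inv_le_one_add_log Q) (by positivity)

/-- **THEOREM A (CONTINUUM-LIMIT §26.2): the flat window law for the all-integer atom, uniformly in the window.**
For `148 ≤ Q`, `2Q ≤ R` and every `g : ℕ → ℝ`, with `c = exitMassRatio R Q = S_W/H_Q`:

  `(Σ_{Q<x≤R} g(x)/x − c·Σ_{b≤Q} g(b)/b)² ≤ 210000 · (log R/log Q)² · Σ_{x≤R}(1/x)Σ_{n∣x}Λ(n)(g(x) − g(x/n))²`.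

Proof: `window_functional_sq_le_exp_five` with the sharp Green bound `A = 1 + 4/log(Q+1) ≤ 9/5`; the flow term is
`A²·log²R/(2log²Q) ≤ 1.62·X²`, the residual `exitChiSq·⌊log₂Q⌋·e⁵ ≤ 400(1 + log Q)(log²R/log⁴(Q+1))·(log Q/log 2)·e⁵
≤ (480·1.443·e⁵)·X²` (`1 + log Q ≤ (6/5)log(Q+1)`), `X = log R/log Q`. -/
theorem theoremA {R Q : ℕ} (hQ : 148 ≤ Q) (hQR : 2 * Q ≤ R) (g : ℕ → ℝ) :
    (∑ x ∈ Ioc Q R, g x / x - exitMassRatio R Q * ∑ b ∈ Icc 1 Q, g b / b) ^ 2 ≤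
      210000 * (Real.log R / Real.log Q) ^ 2 *
        ∑ x ∈ Icc 1 R, (1 / (x : ℝ)) * ∑ n ∈ x.divisors, vonMangoldt n * (g x - g (x / n)) ^ 2 := by
  have hl2 := Real.log_two_lt_d9
  have hl2' := Real.log_two_gt_d9
  have ha5 := five_le_log_succ hQ
  set a := Real.log ((Q : ℝ) + 1) with ha_def
  set L := Real.log (R : ℝ) with hL_def
  set ℓ := Real.log (Q : ℝ) with hℓ_def
  set D := ∑ x ∈ Icc 1 R, (1 / (x : ℝ)) * ∑ n ∈ x.divisors, vonMangoldt n * (g x - g (x / n)) ^ 2 with hD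
  have hDnn : 0 ≤ D := Finset.sum_nonneg fun x _ => mul_nonneg (by positivity)
    (Finset.sum_nonneg fun n _ => mul_nonneg ArithmeticFunction.vonMangoldt_nonneg (sq_nonneg _))
  -- basic comparisons: 0 < ℓ ≤ a ≤ L, a ≥ 5
  have hQ148 : (148 : ℝ) ≤ Q := by exact_mod_cast hQ
  have hℓa : ℓ ≤ a := Real.log_le_log (by positivity) (by linarith)
  have hℓ0 : 0 < ℓ := Real.log_pos (by linarith)
  have haL : a ≤ L := Real.log_le_log (by positivity) (by
    have : ((2 * Q : ℕ) : ℝ) ≤ R := by exact_mod_cast hQR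
    push_cast at this
    linarith)
  have hℓL : ℓ ≤ L := hℓa.trans haL
  have ha0 : 0 < a := by linarith
  have hL0 : 0 < L := by linarith
  -- X = L/ℓ
  have hX2 : 0 ≤ (L / ℓ) ^ 2 := sq_nonneg _
  -- the skeleton with the sharp Green bound
  have h4a : 0 ≤ 4 / a := by positivity
  have h4a' : 4 / a ≤ 4 / 5 := div_le_div_of_nonneg_left (by norm_num) (by norm_num) ha5
  have hA2 : 1 + 4 / a ≤ 9 / 5 := by linarith
  have hsk := window_functional_sq_le_exp_five (by omega : 2 ≤ Q) (by omega : Q ≤ R) (exitGamma_le_four hQ) g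
  rw [← hD] at hsk
  -- flow term: A² L² (1/(2ℓ²) − 1/(2L²)) ≤ (81/50)·X²
  have hflow : (1 + 4 / a) ^ 2 * L ^ 2 * (1 / (2 * ℓ ^ 2) - 1 / (2 * L ^ 2)) ≤ 81 / 50 * (L / ℓ) ^ 2 := by
    have h1 : (1 + 4 / a) ^ 2 ≤ (9 / 5) ^ 2 := pow_le_pow_left₀ (by linarith) hA2 2
    have h2 : 1 / (2 * ℓ ^ 2) - 1 / (2 * L ^ 2) ≤ 1 / (2 * ℓ ^ 2) := by
      have : 0 ≤ 1 / (2 * L ^ 2) := by positivity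
      linarith
    have h2' : 0 ≤ 1 / (2 * ℓ ^ 2) - 1 / (2 * L ^ 2) := by
      have : 1 / (2 * L ^ 2) ≤ 1 / (2 * ℓ ^ 2) :=
        one_div_le_one_div_of_le (by positivity) (by nlinarith [pow_le_pow_left₀ hℓ0.le hℓL 2])
      linarith
    have h3 : (9 / 5 : ℝ) ^ 2 * L ^ 2 * (1 / (2 * ℓ ^ 2)) = 81 / 50 * (L / ℓ) ^ 2 := by ring
    calc (1 + 4 / a) ^ 2 * L ^ 2 * (1 / (2 * ℓ ^ 2) - 1 / (2 * L ^ 2))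
        ≤ (9 / 5) ^ 2 * L ^ 2 * (1 / (2 * ℓ ^ 2) - 1 / (2 * L ^ 2)) :=
          mul_le_mul_of_nonneg_right (mul_le_mul_of_nonneg_right h1 (sq_nonneg _)) h2'
      _ ≤ (9 / 5) ^ 2 * L ^ 2 * (1 / (2 * ℓ ^ 2)) := mul_le_mul_of_nonneg_left h2 (by positivity)
      _ = 81 / 50 * (L / ℓ) ^ 2 := h3
  -- residual term: exitChiSq·⌊log₂Q⌋·e⁵ ≤ 102900·X²  (PROP. 24.7 on the bottom: ⌊log₂Q⌋ ≤ 1.443·ℓ)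
  have hres : exitChiSq R Q * ((Nat.log 2 Q : ℝ) * Real.exp 5) ≤ 102900 * (L / ℓ) ^ 2 := by
    have hχ := exitChiSq_le_sharp hQ hQR
    have he := exp_five_lt
    have he0 : 0 < Real.exp 5 := Real.exp_pos 5
    -- exitChiSq ≤ (1+ℓ)·400·L²/a⁴ ≤ (6/5)a·400 L²/a⁴ = 480 L²/a³ ≤ 480 L²/ℓ³
    have hχ2 : exitChiSq R Q ≤ 480 * L ^ 2 / ℓ ^ 3 := by
      have h1 : (1 + ℓ) * (20 * L / a ^ 2) ^ 2 = (1 + ℓ) * (400 * L ^ 2 / a ^ 4) := by ring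
      have h2 : (1 + ℓ) ≤ 6 / 5 * a := by linarith
      have h3 : (1 + ℓ) * (400 * L ^ 2 / a ^ 4) ≤ 6 / 5 * a * (400 * L ^ 2 / a ^ 4) :=
        mul_le_mul_of_nonneg_right h2 (by positivity)
      have h4 : 6 / 5 * a * (400 * L ^ 2 / a ^ 4) = 480 * L ^ 2 / a ^ 3 := by
        field_simp
        ring
      have h5 : 480 * L ^ 2 / a ^ 3 ≤ 480 * L ^ 2 / ℓ ^ 3 :=
        div_le_div_of_nonneg_left (by positivity) (by positivity) (pow_le_pow_left₀ hℓ0.le hℓa 3)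
      calc exitChiSq R Q ≤ (1 + ℓ) * (20 * L / a ^ 2) ^ 2 := hχ
        _ = (1 + ℓ) * (400 * L ^ 2 / a ^ 4) := h1
        _ ≤ 6 / 5 * a * (400 * L ^ 2 / a ^ 4) := h3
        _ = 480 * L ^ 2 / a ^ 3 := h4
        _ ≤ 480 * L ^ 2 / ℓ ^ 3 := h5
    -- ⌊log₂Q⌋ ≤ ℓ/log 2 ≤ 1.443·ℓ and e⁵ < 148.42
    have hN : (Nat.log 2 Q : ℝ) ≤ 1.443 * ℓ := by
      have h1 := natLog_two_le_log_div (show 1 ≤ Q by omega)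
      have h2 : ℓ / Real.log 2 ≤ 1.443 * ℓ := by
        rw [div_le_iff₀ (by linarith)]
        have : 0 ≤ ℓ * (1.443 * Real.log 2 - 1) := mul_nonneg hℓ0.le (by linarith)
        linarith
      exact h1.trans h2
    have hNE : (Nat.log 2 Q : ℝ) * Real.exp 5 ≤ 1.443 * ℓ * 148.42 :=
      mul_le_mul hN he.le he0.le (by positivity)
    have hprod : exitChiSq R Q * ((Nat.log 2 Q : ℝ) * Real.exp 5) ≤ (480 * L ^ 2 / ℓ ^ 3) * (1.443 * ℓ * 148.42) :=
      mul_le_mul hχ2 hNE (by positivity) (by positivity)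
    have hid : (480 * L ^ 2 / ℓ ^ 3) * (1.443 * ℓ * 148.42) = 480 * 1.443 * 148.42 * (L / ℓ) ^ 2 := by
      field_simp
    rw [hid] at hprod
    have : 480 * 1.443 * 148.42 * (L / ℓ) ^ 2 ≤ 102900 * (L / ℓ) ^ 2 :=
      mul_le_mul_of_nonneg_right (by norm_num) hX2
    exact hprod.trans this
  -- assemble
  calc (∑ x ∈ Ioc Q R, g x / x - exitMassRatio R Q * ∑ b ∈ Icc 1 Q, g b / b) ^ 2
      ≤ 2 * ((1 + 4 / a) ^ 2 * L ^ 2 * (1 / (2 * ℓ ^ 2) - 1 / (2 * L ^ 2)) +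
          exitChiSq R Q * ((Nat.log 2 Q : ℝ) * Real.exp 5)) * D := hsk
    _ ≤ 2 * (81 / 50 * (L / ℓ) ^ 2 + 102900 * (L / ℓ) ^ 2) * D := by
        refine mul_le_mul_of_nonneg_right ?_ hDnn
        linarith
    _ = (2 * (81 / 50) + 2 * 102900) * ((L / ℓ) ^ 2 * D) := by ring
    _ ≤ 210000 * ((L / ℓ) ^ 2 * D) := mul_le_mul_of_nonneg_right (by norm_num) (mul_nonneg hX2 hDnn)
    _ = 210000 * (L / ℓ) ^ 2 * D := by ring

end Summit.RiemannHypothesis.RiemannHypothesis.Theorems.IntegerScrew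

end
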